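import Mathlib.Algebra.CharP.Lemmas
import Mathlib.Algebra.Algebra.Subalgebra.Lattice

/-!
# `Valuative.TorsorToLurel`: `p`-radical elements over a subalgebra form a subalgebra

Route `ResolutionOfSingularities/Valuative`, support item `TorsorToLurel`
(stmt-ResolutionOfSingularities-10968), line `Sketch` (perfect-closure descent). Helper file.

Inside a field `K'` of characteristic `p`, let `B` and `C` be `k`-subalgebras such that every
element of `C` has some `p ^ t`-th power in `B`. Then every element of the compositum `B ⊔ C`
has some `p ^ t`-th power in `B` (`stub_ttlPRadicalSup`): the set of such elements is a
`k`-subalgebra containing `B` and `C`, because the iterated Frobenius `z ↦ z ^ p ^ t` is a ring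
homomorphism (`add_pow_char_pow`).
-/

noncomputable section

set_option linter.dupNamespace false -- mandated namespace of this single-conjunct summit

namespace Summit.ResolutionOfSingularities.ResolutionOfSingularities.Theorems

/-- **`p`-radical closure of a subalgebra is closed under `⊔`.** In a field `K'` of
characteristic `p`, if every element of the `k`-subalgebra `C` has some `p ^ t`-th power in the
`k`-subalgebra `B`, then so does every element of `B ⊔ C`. -/
theorem stub_ttlPRadicalSup (p : ℕ) [Fact p.Prime] (k K' : Type) [Field k] [Field K'] [CharP K' p]
    [Algebra k K'] (B C : Subalgebra k K') (hC : ∀ c ∈ C, ∃ t : ℕ, c ^ p ^ t ∈ B) :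
    ∀ z ∈ B ⊔ C, ∃ t : ℕ, z ^ p ^ t ∈ B := by
  -- Raising the exponent keeps the power inside `B`.
  have hmono : ∀ (z : K') (s t : ℕ), z ^ p ^ s ∈ B → z ^ p ^ (s + t) ∈ B := fun z s t hz => by
    rw [pow_add, pow_mul]
    exact B.pow_mem hz _
  have hmono' : ∀ (z : K') (s t : ℕ), z ^ p ^ t ∈ B → z ^ p ^ (s + t) ∈ B := fun z s t hz => by
    rw [add_comm]
    exact hmono z t s hz
  -- The `p`-radical elements over `B` form a `k`-subalgebra `S` of `K'`.
  let S : Subalgebra k K' :=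
    { carrier := {z | ∃ t : ℕ, z ^ p ^ t ∈ B}
      mul_mem' := by
        rintro x y ⟨s, hs⟩ ⟨t, ht⟩
        refine ⟨s + t, ?_⟩
        rw [mul_pow]
        exact B.mul_mem (hmono x s t hs) (hmono' y s t ht)
      one_mem' := ⟨0, by rw [pow_zero, pow_one]; exact B.one_mem⟩
      add_mem' := by
        rintro x y ⟨s, hs⟩ ⟨t, ht⟩
        refine ⟨s + t, ?_⟩
        rw [add_pow_char_pow x y p (s + t)]
        exact B.add_mem (hmono x s t hs) (hmono' y s t ht)
      zero_mem' := ⟨0, by rw [pow_zero, pow_one]; exact B.zero_mem⟩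
      algebraMap_mem' := fun r => ⟨0, by rw [pow_zero, pow_one]; exact B.algebraMap_mem r⟩ }
  have hB : B ≤ S := fun z hz => ⟨0, by rw [pow_zero, pow_one]; exact hz⟩
  have hCS : C ≤ S := fun c hc => hC c hc
  intro z hz
  exact sup_le hB hCS hz

end Summit.ResolutionOfSingularities.ResolutionOfSingularities.Theorems

end
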